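import Summits.Ventures.PercRepro.ProfileGapMonoQ

/-!
# PercRepro — THE GAP-MONOTONICITY CONJECTURE AT A PARALLEL ELEMENT: `(GM)_q` at `z ∥ z'` is the co-rank-`(q−1)`
row of `(N ∖ z) ／ z'` at the level `u − 1` (p10, gen 7; `proofs/P10-AVFULL.md` §13)

For a parallel pair `z ∥ z'` every statistic `Σ_X φ(ρ(X), ρ(E ∖ X))` of `N` is the same statistic of
`N' := N ∖ z` plus twice the sum over the sets `A ∋ z'` of `φ(ρ'(A), ρ'((E' ∖ A) ∪ z'))` (`sum_parallel_transfer`);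
through `A = A' ∪ z'` these are the sets of `N'' := N' ／ z'` with both ranks raised by one.  Applied to the
rank-`q` demands and to the co-rank-`q` level set, `GapMonoQ N z q u` becomes
`Σ_{ρ''(A') = q−1, ρ''(E''∖A') ≥ u−1} C(ρ''(E''∖A') + 1, u−q) ≤ C(u,q) · W⁻_{q−1,u−1}(N'')`, which follows from the
co-rank-`(q−1)` row of `N''` at the level `u − 1` and the termwise `q · C(r+1, u−q) ≤ u · C(r, u−q)` (`r ≥ u−1`).
So in the induction of `profileIneqMinusQ_of_gapMonoRuleQ` (run for all `(q, u)` at once) a parallel element is a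
gap-monotone point; with `gapMonoQ_of_loop`, the rule only has to be checked on SIMPLE matroids.

* `rk_insert_parallel_eq`, `sum_parallel_transfer`, `sum_parallel_contract`, `choose_succ_mul_le`,
  `sum_demand_eq_powerset`, `card_levelSetCoQ_eq_powerset`, **`gapMonoQ_of_parallel`**.
-/

open scoped Matroid

namespace PercRepro.Cogirth

open Finset ThmH Skew Shadow Profile

variable {α : Type} [DecidableEq α] {N : Matroid α} [N.Finite]

/-- For a parallel pair `z ∥ z'` and `W ⊆ E` avoiding both, `ρ(W ∪ z) = ρ(W ∪ z')`. -/
theorem rk_insert_parallel_eq {z z' : α} (hz : z ∈ gr N) (hz' : z' ∈ gr N) (h0 : rk N {z} = 1)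
    (h1 : rk N {z'} = 1) (hpar : rk N {z, z'} = 1) {W : Finset α} (hW : W ⊆ gr N) :
    rk N (insert z W) = rk N (insert z' W) := by
  -- `z ∈ cl {z'}` and `z' ∈ cl {z}`
  have hz'cl : z ∈ clF N {z'} := by
    rw [mem_clF_iff_rk_insert_eq hz (singleton_subset_iff.2 hz'), h1]
    exact hpar
  have hzcl : z' ∈ clF N {z} := by
    rw [mem_clF_iff_rk_insert_eq hz' (singleton_subset_iff.2 hz), pair_comm, h0]
    exact hpar
  have hA : rk N (insert z' (insert z W)) = rk N (insert z W) := by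
    rw [rk_insert_eq hz' (insert_subset hz hW), if_pos]
    exact clF_mono_sub (by intro x hx; rw [mem_singleton] at hx; rw [hx]; exact mem_insert_self _ _) hzcl
  have hB : rk N (insert z (insert z' W)) = rk N (insert z' W) := by
    rw [rk_insert_eq hz (insert_subset hz' hW), if_pos]
    exact clF_mono_sub (by intro x hx; rw [mem_singleton] at hx; rw [hx]; exact mem_insert_self _ _) hz'cl
  rw [← hA, ← hB, insert_comm]

/-- **The parallel transfer**: for `z ∥ z'` and any `φ`,
`Σ_{X ⊆ E} φ(ρ X, ρ(E∖X)) = Σ_{Y ⊆ E'} φ(ρ' Y, ρ'(E'∖Y)) + 2 · Σ_{A ⊆ E', z' ∈ A} φ(ρ' A, ρ'((E'∖A) ∪ z'))`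
(`E' = E ∖ z`, `ρ'` the rank of `N ∖ z`). -/
theorem sum_parallel_transfer {z z' : α} (hz : z ∈ gr N) (hz' : z' ∈ gr N) (hzz' : z ≠ z')
    (h0 : rk N {z} = 1) (h1 : rk N {z'} = 1) (hpar : rk N {z, z'} = 1) (φ : ℕ → ℕ → ℕ) :
    ∑ X ∈ (gr N).powerset, φ (rk N X) (rk N (gr N \ X)) =
      ∑ Y ∈ (gr (N ＼ ({z} : Set α))).powerset, φ (rk (N ＼ ({z} : Set α)) Y) (rk (N ＼ ({z} : Set α)) (gr (N ＼ ({z} : Set α)) \ Y)) +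
      2 * ∑ A ∈ (gr (N ＼ ({z} : Set α))).powerset.filter (fun A => z' ∈ A),
        φ (rk (N ＼ ({z} : Set α)) A) (rk (N ＼ ({z} : Set α)) (insert z' (gr (N ＼ ({z} : Set α)) \ A))) := by
  rw [gr_delete']
  set E' := (gr N).erase z with hE'
  have hE'sub : E' ⊆ gr N := erase_subset _ _
  have hz'E' : z' ∈ E' := mem_erase.2 ⟨Ne.symm hzz', hz'⟩
  have hzE' : z ∉ E' := notMem_erase _ _
  -- ranks of `N ∖ z` are ranks of `N`
  have hrk : ∀ W ⊆ E', rk (N ＼ ({z} : Set α)) W = rk N W := fun W hW => rk_delete hW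
  -- split the subsets of `E` by `z ∈ X`
  rw [← sum_filter_add_sum_filter_not ((gr N).powerset) (fun X => z ∈ X)]
  -- the subsets avoiding `z` are the subsets of `E'`; their complement in `E` is `(E' ∖ Y) ∪ z`
  have hnot : ∑ X ∈ (gr N).powerset.filter (fun X => ¬ z ∈ X), φ (rk N X) (rk N (gr N \ X)) =
      ∑ Y ∈ E'.powerset, φ (rk N Y) (rk N (insert z' (E' \ Y))) := by
    apply sum_congr
    · ext Y
      rw [mem_filter, mem_powerset, mem_powerset, hE', subset_erase]
    · intro Y hY
      rw [mem_powerset] at hY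
      have hset : gr N \ Y = insert z (E' \ Y) := by
        ext x
        rw [hE']
        simp only [mem_sdiff, mem_insert, mem_erase]
        constructor
        · rintro ⟨hxE, hxY⟩
          by_cases hxz : x = z
          · exact Or.inl hxz
          · exact Or.inr ⟨⟨hxz, hxE⟩, hxY⟩
        · rintro (rfl | ⟨⟨_, hxE⟩, hxY⟩)
          · exact ⟨hz, fun h => hzE' (hY h)⟩
          · exact ⟨hxE, hxY⟩
      rw [hset, rk_insert_parallel_eq hz hz' h0 h1 hpar (sdiff_subset.trans hE'sub)]
  -- the subsets containing `z` are `insert z Y`, `Y ⊆ E'`; their rank is `ρ(insert z' Y)`, the complement is `E' ∖ Y`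
  have hmem : ∑ X ∈ (gr N).powerset.filter (fun X => z ∈ X), φ (rk N X) (rk N (gr N \ X)) =
      ∑ Y ∈ E'.powerset, φ (rk N (insert z' Y)) (rk N (E' \ Y)) := by
    symm
    apply sum_nbij' (fun Y => insert z Y) (fun X => X.erase z)
    · intro Y hY
      rw [mem_powerset] at hY
      rw [mem_filter, mem_powerset]
      exact ⟨insert_subset hz (hY.trans hE'sub), mem_insert_self _ _⟩
    · intro X hX
      rw [mem_filter, mem_powerset] at hX
      rw [mem_powerset, hE', subset_erase]
      exact ⟨(erase_subset _ _).trans hX.1, notMem_erase _ _⟩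
    · intro Y hY
      rw [mem_powerset] at hY
      exact erase_insert (fun h => hzE' (hY h))
    · intro X hX
      rw [mem_filter] at hX
      exact insert_erase hX.2
    · intro Y hY
      rw [mem_powerset] at hY
      have hzY : z ∉ Y := fun h => hzE' (hY h)
      have hset : gr N \ insert z Y = E' \ Y := by
        ext x
        rw [hE']
        simp only [mem_sdiff, mem_insert, mem_erase, not_or]
        tauto
      rw [hset, rk_insert_parallel_eq hz hz' h0 h1 hpar (hY.trans hE'sub)]
  rw [hmem, hnot]
  -- now regroup by `z' ∈ Y`
  have hsplit1 : ∑ Y ∈ E'.powerset, φ (rk N (insert z' Y)) (rk N (E' \ Y)) =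
      ∑ Y ∈ E'.powerset.filter (fun Y => z' ∈ Y), φ (rk N Y) (rk N (E' \ Y)) +
      ∑ Y ∈ E'.powerset.filter (fun Y => ¬ z' ∈ Y), φ (rk N (insert z' Y)) (rk N (insert z' (E' \ insert z' Y))) := by
    rw [← sum_filter_add_sum_filter_not (E'.powerset) (fun Y => z' ∈ Y)]
    congr 1
    · apply sum_congr rfl
      intro Y hY
      rw [mem_filter] at hY
      rw [insert_eq_of_mem hY.2]
    · apply sum_congr rfl
      intro Y hY
      rw [mem_filter] at hY
      have hset : insert z' (E' \ insert z' Y) = E' \ Y := by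
        ext x
        simp only [mem_insert, mem_sdiff, not_or]
        constructor
        · rintro (rfl | ⟨hxE, _, hxY⟩)
          · exact ⟨hz'E', hY.2⟩
          · exact ⟨hxE, hxY⟩
        · rintro ⟨hxE, hxY⟩
          by_cases hxz : x = z'
          · exact Or.inl hxz
          · exact Or.inr ⟨hxE, hxz, hxY⟩
      rw [hset]
  have hsplit2 : ∑ Y ∈ E'.powerset, φ (rk N Y) (rk N (insert z' (E' \ Y))) =
      ∑ Y ∈ E'.powerset.filter (fun Y => z' ∈ Y), φ (rk N Y) (rk N (insert z' (E' \ Y))) +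
      ∑ Y ∈ E'.powerset.filter (fun Y => ¬ z' ∈ Y), φ (rk N Y) (rk N (E' \ Y)) := by
    rw [← sum_filter_add_sum_filter_not (E'.powerset) (fun Y => z' ∈ Y)]
    congr 1
    apply sum_congr rfl
    intro Y hY
    rw [mem_filter] at hY
    rw [insert_eq_of_mem (mem_sdiff.2 ⟨hz'E', hY.2⟩)]
  -- the sets not containing `z'`, with `z'` inserted, are the sets containing `z'`
  have hbij : ∑ Y ∈ E'.powerset.filter (fun Y => ¬ z' ∈ Y), φ (rk N (insert z' Y)) (rk N (insert z' (E' \ insert z' Y))) =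
      ∑ A ∈ E'.powerset.filter (fun A => z' ∈ A), φ (rk N A) (rk N (insert z' (E' \ A))) := by
    apply sum_nbij' (fun Y => insert z' Y) (fun A => A.erase z')
    · intro Y hY
      rw [mem_filter, mem_powerset] at hY ⊢
      exact ⟨insert_subset hz'E' hY.1, mem_insert_self _ _⟩
    · intro A hA
      rw [mem_filter, mem_powerset] at hA ⊢
      exact ⟨(erase_subset _ _).trans hA.1, notMem_erase _ _⟩
    · intro Y hY
      rw [mem_filter] at hY
      exact erase_insert hY.2
    · intro A hA
      rw [mem_filter] at hA
      exact insert_erase hA.2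
    · intro Y _
      rfl
  rw [hsplit1, hsplit2, hbij, two_mul]
  -- the ranks in `N ∖ z` are the ranks in `N`; assemble
  have hall : ∑ Y ∈ E'.powerset, φ (rk (N ＼ ({z} : Set α)) Y) (rk (N ＼ ({z} : Set α)) (E' \ Y)) =
      ∑ Y ∈ E'.powerset.filter (fun Y => z' ∈ Y), φ (rk N Y) (rk N (E' \ Y)) +
      ∑ Y ∈ E'.powerset.filter (fun Y => ¬ z' ∈ Y), φ (rk N Y) (rk N (E' \ Y)) := by
    rw [← sum_filter_add_sum_filter_not (E'.powerset) (fun Y => z' ∈ Y)]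
    congr 1
    · apply sum_congr rfl
      intro Y hY
      rw [mem_filter, mem_powerset] at hY
      rw [hrk Y hY.1, hrk (E' \ Y) sdiff_subset]
    · apply sum_congr rfl
      intro Y hY
      rw [mem_filter, mem_powerset] at hY
      rw [hrk Y hY.1, hrk (E' \ Y) sdiff_subset]
  have hA' : ∑ A ∈ E'.powerset.filter (fun A => z' ∈ A),
      φ (rk (N ＼ ({z} : Set α)) A) (rk (N ＼ ({z} : Set α)) (insert z' (E' \ A))) =
      ∑ A ∈ E'.powerset.filter (fun A => z' ∈ A), φ (rk N A) (rk N (insert z' (E' \ A))) := by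
    apply sum_congr rfl
    intro A hA
    rw [mem_filter, mem_powerset] at hA
    rw [hrk A hA.1, hrk _ (insert_subset hz'E' sdiff_subset)]
  rw [hall, hA']
  ring

/-- The sets `A ∋ z'` of `N` and the sets of `N ／ z'`: `Σ_{A ∋ z'} φ(ρ A, ρ(insert z' (E ∖ A))) = Σ_{A' ⊆ E''} φ(ρ'' A' + 1, ρ''(E'' ∖ A') + 1)`
(`z'` a non-loop). -/
theorem sum_parallel_contract {z' : α} (hz'I : N.Indep {z'}) (φ : ℕ → ℕ → ℕ) :
    ∑ A ∈ (gr N).powerset.filter (fun A => z' ∈ A), φ (rk N A) (rk N (insert z' (gr N \ A))) =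
      ∑ A' ∈ (gr (N ／ ({z'} : Set α))).powerset,
        φ (rk (N ／ ({z'} : Set α)) A' + 1) (rk (N ／ ({z'} : Set α)) (gr (N ／ ({z'} : Set α)) \ A') + 1) := by
  have hz' : z' ∈ gr N := mem_gr_of_indep hz'I
  rw [gr_contract']
  symm
  apply sum_nbij' (fun A' => insert z' A') (fun A => A.erase z')
  · intro A' hA'
    rw [mem_powerset] at hA'
    rw [mem_filter, mem_powerset]
    exact ⟨insert_subset hz' (hA'.trans (erase_subset _ _)), mem_insert_self _ _⟩
  · intro A hA
    rw [mem_filter, mem_powerset] at hA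
    rw [mem_powerset, subset_erase]
    exact ⟨(erase_subset _ _).trans hA.1, notMem_erase _ _⟩
  · intro A' hA'
    rw [mem_powerset, subset_erase] at hA'
    exact erase_insert hA'.2
  · intro A hA
    rw [mem_filter] at hA
    exact insert_erase hA.2
  · intro A' hA'
    rw [mem_powerset] at hA'
    have hset : gr N \ insert z' A' = (gr N).erase z' \ A' := by
      ext x
      simp only [mem_sdiff, mem_insert, mem_erase, not_or]
      tauto
    rw [hset, ← rk_contract_add_one hz'I hA', ← rk_contract_add_one hz'I sdiff_subset]

/-- `q · C(r+1, u−q) ≤ u · C(r, u−q)` for `1 ≤ q < u ≤ r + 1`. -/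
theorem choose_succ_mul_le {q u r : ℕ} (hq : 1 ≤ q) (hqu : q < u) (hr : u ≤ r + 1) :
    q * (r + 1).choose (u - q) ≤ u * r.choose (u - q) := by
  have h := Nat.choose_mul_succ_eq r (u - q)
  have hpos : 0 < r + 1 - (u - q) := by omega
  have key : q * (r + 1) ≤ u * (r + 1 - (u - q)) := by
    have h2 : (u - q) * (u - 1) ≤ (u - q) * r := Nat.mul_le_mul_left _ (by omega)
    zify [(by omega : u - q ≤ r + 1), (by omega : q ≤ u), (by omega : 1 ≤ u)] at h2 ⊢
    nlinarith [h2]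
  have H : q * (r + 1).choose (u - q) * (r + 1 - (u - q)) ≤ u * r.choose (u - q) * (r + 1 - (u - q)) := by
    calc q * (r + 1).choose (u - q) * (r + 1 - (u - q))
        = q * ((r + 1).choose (u - q) * (r + 1 - (u - q))) := by ring
      _ = q * (r.choose (u - q) * (r + 1)) := by rw [h]
      _ = (q * (r + 1)) * r.choose (u - q) := by ring
      _ ≤ (u * (r + 1 - (u - q))) * r.choose (u - q) := Nat.mul_le_mul_right _ key
      _ = u * r.choose (u - q) * (r + 1 - (u - q)) := by ring
  exact Nat.le_of_mul_le_mul_right H hpos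

/-- The rank-`q` demand sum as a statistic over the power set. -/
theorem sum_demand_eq_powerset (K : Matroid α) [K.Finite] (q u : ℕ) :
    ∑ B ∈ Rq K q, demand K q u B = ∑ X ∈ (gr K).powerset,
      (fun a b => if a = q then (if u ≤ b then b.choose (u - q) else 0) else 0) (rk K X) (rk K (gr K \ X)) := by
  have hR : Rq K q = (gr K).powerset.filter (fun X => rk K X = q) := by
    ext X
    rw [mem_Rq, mem_filter, mem_powerset]
    constructor
    · rintro ⟨h1, h2⟩
      refine ⟨h1, ?_⟩
      rw [← coe_rk] at h2
      exact_mod_cast h2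
    · rintro ⟨h1, h2⟩
      refine ⟨h1, ?_⟩
      rw [← coe_rk, h2]
  rw [hR, sum_filter]
  apply sum_congr rfl
  intro X _
  unfold demand
  rfl

/-- The co-rank-`q` level count as a statistic over the power set. -/
theorem card_levelSetCoQ_eq_powerset (K : Matroid α) [K.Finite] (q u : ℕ) :
    (levelSetCoQ K q u).card = ∑ X ∈ (gr K).powerset,
      (fun a b => if a = u then (if q ≤ b then 1 else 0) else 0) (rk K X) (rk K (gr K \ X)) := by
  have hL : levelSetCoQ K q u = (gr K).powerset.filter (fun X => rk K X = u ∧ q ≤ rk K (gr K \ X)) := by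
    ext X
    rw [mem_levelSetCoQ, mem_filter, mem_powerset]
    constructor
    · rintro ⟨⟨h1, h2⟩, h3⟩
      refine ⟨h1, ?_, h3⟩
      rw [← coe_rk] at h2
      exact_mod_cast h2
    · rintro ⟨h1, h2, h3⟩
      refine ⟨⟨h1, ?_⟩, h3⟩
      rw [← coe_rk, h2]
  rw [hL, card_eq_sum_ones, sum_filter]
  apply sum_congr rfl
  intro X _
  simp only [ite_and]

/-- **`(GM)_q` at a parallel element**: for `z ∥ z'`, `GapMonoQ N z q u` follows from the co-rank-`(q−1)` row of
`(N ∖ z) ／ z'` at the level `u − 1` (`1 ≤ q < u`). -/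
theorem gapMonoQ_of_parallel {z z' : α} (hz : z ∈ gr N) (hz' : z' ∈ gr N) (hzz' : z ≠ z')
    (h0 : rk N {z} = 1) (h1 : rk N {z'} = 1) (hpar : rk N {z, z'} = 1) {q u : ℕ} (hq : 1 ≤ q) (hqu : q < u)
    (hdel : ProfileIneqMinusQ ((N ＼ ({z} : Set α)) ／ ({z'} : Set α)) (q - 1) (u - 1)) : GapMonoQ N z q u := by
  unfold GapMonoQ
  unfold ProfileIneqMinusQ at hdel
  have hz'E' : z' ∈ gr (N ＼ ({z} : Set α)) := by
    rw [gr_delete']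
    exact mem_erase.2 ⟨Ne.symm hzz', hz'⟩
  have hz'E'' : z' ∈ (gr N).erase z := mem_erase.2 ⟨Ne.symm hzz', hz'⟩
  have hz'I : (N ＼ ({z} : Set α)).Indep {z'} := by
    have h := indep_of_rk_eq_card (M := N ＼ ({z} : Set α)) (X := {z'})
      (by rw [card_singleton, rk_delete (singleton_subset_iff.2 hz'E'')]; exact h1)
    rwa [coe_singleton] at h
  -- the two statistics of `N` through the transfer and the contraction
  have hD := sum_parallel_transfer hz hz' hzz' h0 h1 hpar
    (fun a b => if a = q then (if u ≤ b then b.choose (u - q) else 0) else 0)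
  have hW := sum_parallel_transfer hz hz' hzz' h0 h1 hpar
    (fun a b => if a = u then (if q ≤ b then 1 else 0) else 0)
  rw [sum_parallel_contract hz'I (fun a b => if a = q then (if u ≤ b then b.choose (u - q) else 0) else 0)] at hD
  rw [sum_parallel_contract hz'I (fun a b => if a = u then (if q ≤ b then 1 else 0) else 0)] at hW
  rw [sum_demand_eq_powerset N q u, sum_demand_eq_powerset (N ＼ ({z} : Set α)) q u,
    card_levelSetCoQ_eq_powerset N q u, card_levelSetCoQ_eq_powerset (N ＼ ({z} : Set α)) q u, hD, hW]
  rw [sum_demand_eq_powerset, card_levelSetCoQ_eq_powerset] at hdel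
  beta_reduce at hdel
  -- termwise comparison with the row of `N''`
  have hterm : q * ∑ A' ∈ (gr ((N ＼ ({z} : Set α)) ／ ({z'} : Set α))).powerset,
        (if rk ((N ＼ ({z} : Set α)) ／ ({z'} : Set α)) A' + 1 = q then
          (if u ≤ rk ((N ＼ ({z} : Set α)) ／ ({z'} : Set α)) (gr ((N ＼ ({z} : Set α)) ／ ({z'} : Set α)) \ A') + 1 then
            (rk ((N ＼ ({z} : Set α)) ／ ({z'} : Set α)) (gr ((N ＼ ({z} : Set α)) ／ ({z'} : Set α)) \ A') + 1).choose (u - q)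
          else 0) else 0) ≤
      u * ∑ A' ∈ (gr ((N ＼ ({z} : Set α)) ／ ({z'} : Set α))).powerset,
        (if rk ((N ＼ ({z} : Set α)) ／ ({z'} : Set α)) A' = q - 1 then
          (if u - 1 ≤ rk ((N ＼ ({z} : Set α)) ／ ({z'} : Set α)) (gr ((N ＼ ({z} : Set α)) ／ ({z'} : Set α)) \ A') then
            (rk ((N ＼ ({z} : Set α)) ／ ({z'} : Set α)) (gr ((N ＼ ({z} : Set α)) ／ ({z'} : Set α)) \ A')).choose (u - 1 - (q - 1))
          else 0) else 0) := by
    rw [mul_sum, mul_sum]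
    apply sum_le_sum
    intro A' _
    split_ifs with ha hb ha' hb' <;> first | omega | skip
    · rw [show u - 1 - (q - 1) = u - q by omega]
      exact choose_succ_mul_le hq hqu (by omega)
  have hWeq : ∑ A' ∈ (gr ((N ＼ ({z} : Set α)) ／ ({z'} : Set α))).powerset,
        (if rk ((N ＼ ({z} : Set α)) ／ ({z'} : Set α)) A' + 1 = u then
          (if q ≤ rk ((N ＼ ({z} : Set α)) ／ ({z'} : Set α)) (gr ((N ＼ ({z} : Set α)) ／ ({z'} : Set α)) \ A') + 1 then 1 else 0)
          else 0) =
      ∑ A' ∈ (gr ((N ＼ ({z} : Set α)) ／ ({z'} : Set α))).powerset,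
        (if rk ((N ＼ ({z} : Set α)) ／ ({z'} : Set α)) A' = u - 1 then
          (if q - 1 ≤ rk ((N ＼ ({z} : Set α)) ／ ({z'} : Set α)) (gr ((N ＼ ({z} : Set α)) ／ ({z'} : Set α)) \ A') then 1 else 0)
          else 0) := by
    apply sum_congr rfl
    intro A' _
    split_ifs <;> omega
  have hcq : u * (u - 1).choose (q - 1) = q * u.choose q := by
    have := Nat.add_one_mul_choose_eq (u - 1) (q - 1)
    rw [show u - 1 + 1 = u by omega, show q - 1 + 1 = q by omega] at this
    rw [this]
    ring
  rw [hWeq]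
  -- assemble: `q · S_D ≤ u · S'_D ≤ u · C(u−1,q−1) · S'_W = q · C(u,q) · S_W`
  generalize hSD : (∑ A' ∈ (gr ((N ＼ ({z} : Set α)) ／ ({z'} : Set α))).powerset,
      (if rk ((N ＼ ({z} : Set α)) ／ ({z'} : Set α)) A' + 1 = q then
        (if u ≤ rk ((N ＼ ({z} : Set α)) ／ ({z'} : Set α)) (gr ((N ＼ ({z} : Set α)) ／ ({z'} : Set α)) \ A') + 1 then
          (rk ((N ＼ ({z} : Set α)) ／ ({z'} : Set α)) (gr ((N ＼ ({z} : Set α)) ／ ({z'} : Set α)) \ A') + 1).choose (u - q)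
        else 0) else 0)) = SD at hterm ⊢
  generalize hSD' : (∑ A' ∈ (gr ((N ＼ ({z} : Set α)) ／ ({z'} : Set α))).powerset,
      (if rk ((N ＼ ({z} : Set α)) ／ ({z'} : Set α)) A' = q - 1 then
        (if u - 1 ≤ rk ((N ＼ ({z} : Set α)) ／ ({z'} : Set α)) (gr ((N ＼ ({z} : Set α)) ／ ({z'} : Set α)) \ A') then
          (rk ((N ＼ ({z} : Set α)) ／ ({z'} : Set α)) (gr ((N ＼ ({z} : Set α)) ／ ({z'} : Set α)) \ A')).choose (u - 1 - (q - 1))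
        else 0) else 0)) = SD' at hterm hdel
  generalize hSW : (∑ A' ∈ (gr ((N ＼ ({z} : Set α)) ／ ({z'} : Set α))).powerset,
      (if rk ((N ＼ ({z} : Set α)) ／ ({z'} : Set α)) A' = u - 1 then
        (if q - 1 ≤ rk ((N ＼ ({z} : Set α)) ／ ({z'} : Set α)) (gr ((N ＼ ({z} : Set α)) ／ ({z'} : Set α)) \ A') then 1 else 0)
        else 0)) = SW at hdel ⊢
  generalize (∑ X ∈ (gr (N ＼ ({z} : Set α))).powerset,
      (if rk (N ＼ ({z} : Set α)) X = q then
        (if u ≤ rk (N ＼ ({z} : Set α)) (gr (N ＼ ({z} : Set α)) \ X) then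
          (rk (N ＼ ({z} : Set α)) (gr (N ＼ ({z} : Set α)) \ X)).choose (u - q) else 0) else 0)) = DN' at ⊢
  generalize (∑ X ∈ (gr (N ＼ ({z} : Set α))).powerset,
      (if rk (N ＼ ({z} : Set α)) X = u then
        (if q ≤ rk (N ＼ ({z} : Set α)) (gr (N ＼ ({z} : Set α)) \ X) then 1 else 0) else 0)) = WN' at ⊢
  have hkey : q * SD ≤ q * (u.choose q * SW) := by
    calc q * SD ≤ u * SD' := hterm
      _ ≤ u * ((u - 1).choose (q - 1) * SW) := Nat.mul_le_mul_left _ hdel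
      _ = (u * (u - 1).choose (q - 1)) * SW := by ring
      _ = (q * u.choose q) * SW := by rw [hcq]
      _ = q * (u.choose q * SW) := by ring
  have hSDle : SD ≤ u.choose q * SW := Nat.le_of_mul_le_mul_left hkey (by omega)
  have e1 : u.choose q * (WN' + 2 * SW) = u.choose q * WN' + 2 * (u.choose q * SW) := by ring
  rw [e1]
  omega

end PercRepro.Cogirth
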